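import Mathlib
import Summits.AtomisticToContinuum.HydrodynamicLimit.Theorems.InformationPercolationEngineKickFairRelEquilibriumCondExpDensity

/-!
# Crux idea `unstable-leaf-reweighting` — first lemmas (crux stmt-AtomisticToContinuum-15177,
`InformationPercolationEngine.KickFairRelEquilibriumMeso`; crux-ideate round 2, ideator 5)

The lever in abstract form. Three σ-algebras on phase space at a flight start: the PAST atom
algebra `mP` (cells, velocity data, partner, times), the LEAF algebra `mL ⊇ mP` (atoms = local
unstable leaves of the hard-sphere flow; the coarse past is backward-determined, hence constant on
u-leaves up to boundary slivers), and Borel `m0`. The evolved local Gibbs law is `G.withDensity W`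
with `W = (dLG/dG) ∘ Φ_{-t}` (invariance of `G`), and `W` is (nearly) `mL`-measurable because
backward orbits of points on one local unstable leaf converge ("u-smoothness of pushed-forward
smooth measures"). LEAFWISE FAIRNESS `G[g | mL] = G[g | mP]` (the next impact parameter
equidistributes along every long u-leaf: one flight of lever arm `ℓ_f ≫ ε`) then transfers to the
evolved law for EVERY transversal (leaf-weight) measure: `transversal_reweighting` (PROVED below, from
the landed p99854 `condExp_withDensity_ae_eq_of_measurable` + the tower property), with an
approximate version stated (`transversal_reweighting_approx`). The kinematic dichotomy behind the
card's exact-velocity analysis is typed as `leverArm_exactVelocity` / `leverArm_leaf`.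
-/

noncomputable section

open MeasureTheory Set Filter Topology
open scoped ENNReal

namespace Summit.AtomisticToContinuum.HydrodynamicLimit.Cruxes.KickFairRelEquilibriumMeso.LeafReweighting

/-- **Transversal reweighting lemma (exact form).** `mP ≤ mL ≤ m0`; `ρ` an `mL`-measurable
(leaf-measurable) density; if `g` is leafwise fair under `ν` — conditioning down from the past
`mP` to the leaf `mL` does not change its conditional mean — then its conditional mean given the
past is the same under `ν.withDensity ρ` as under `ν`, whatever the (transversal) reweighting `ρ`.
[folklore; tower property + p99854] -/
theorem transversal_reweighting
    {Ω : Type*} {mP mL m0 : MeasurableSpace Ω} (hPL : mP ≤ mL) (hL0 : mL ≤ m0)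
    (ν : Measure Ω) [IsFiniteMeasure ν] (ρ : Ω → NNReal) (hρ : Measurable[mL] ρ)
    [IsFiniteMeasure (ν.withDensity fun x => (ρ x : ℝ≥0∞))]
    (g : Ω → ℝ) (hg : Integrable g ν) (hρg : Integrable (fun x => (ρ x : ℝ) * g x) ν)
    (hρc : Integrable (fun x => (ρ x : ℝ) * (MeasureTheory.condExp mP ν g) x) ν)
    (hleaf : MeasureTheory.condExp mL ν g =ᵐ[ν] MeasureTheory.condExp mP ν g) :
    MeasureTheory.condExp mP (ν.withDensity fun x => (ρ x : ℝ≥0∞)) g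
      =ᵐ[ν.withDensity fun x => (ρ x : ℝ≥0∞)] MeasureTheory.condExp mP ν g := by
  set νρ : Measure Ω := ν.withDensity fun x => (ρ x : ℝ≥0∞) with hνρ
  have hP0 : mP ≤ m0 := hPL.trans hL0
  haveI : IsFiniteMeasure (νρ.trim hL0) := isFiniteMeasure_trim hL0
  haveI : IsFiniteMeasure (νρ.trim hP0) := isFiniteMeasure_trim hP0
  -- Step B: leaf-measurable density does not change conditional means given the leaf algebra
  have hB : MeasureTheory.condExp mL νρ g =ᵐ[νρ] MeasureTheory.condExp mL ν g :=
    Summit.AtomisticToContinuum.HydrodynamicLimit.Theorems.condExp_withDensity_ae_eq_of_measurable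
      hL0 ν ρ hρ g hg hρg
  -- Step C: leafwise fairness, transported to `νρ`-a.e. by absolute continuity
  have hac : νρ ≪ ν := withDensity_absolutelyContinuous ν _
  have hC : MeasureTheory.condExp mL ν g =ᵐ[νρ] MeasureTheory.condExp mP ν g := hac.ae_eq hleaf
  -- Step A: tower property under `νρ`
  have hA : MeasureTheory.condExp mP νρ (MeasureTheory.condExp mL νρ g)
      =ᵐ[νρ] MeasureTheory.condExp mP νρ g :=
    condExp_condExp_of_le hPL hL0
  have hD : MeasureTheory.condExp mP νρ (MeasureTheory.condExp mL νρ g)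
      =ᵐ[νρ] MeasureTheory.condExp mP νρ (MeasureTheory.condExp mP ν g) :=
    condExp_congr_ae (hB.trans hC)
  -- Step D: an `mP`-measurable, `νρ`-integrable function is its own conditional expectation
  have hint : Integrable (MeasureTheory.condExp mP ν g) νρ := by
    rw [hνρ, integrable_withDensity_iff_integrable_smul (hρ.mono hL0 le_rfl)]
    refine hρc.congr (Eventually.of_forall fun x => ?_)
    simp only [NNReal.smul_def, smul_eq_mul]
  have hE : MeasureTheory.condExp mP νρ (MeasureTheory.condExp mP ν g)
      = MeasureTheory.condExp mP ν g :=
    condExp_of_stronglyMeasurable hP0 stronglyMeasurable_condExp hint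
  rw [← hE]
  exact hA.symm.trans hD

/-- **Transversal reweighting, approximate form** (the shape the line will use; stated, not proved
here): leafwise fairness up to `η` on `ν`-almost every leaf, a density within a factor `1 + θ` of a
leaf-measurable one, `|g| ≤ C` — then the past-conditional means under the reweighted law and under
`ν` differ by at most `η + 2Cθ` in `L¹` of the reweighted law. [folklore] -/
theorem transversal_reweighting_approx
    {Ω : Type*} {mP mL m0 : MeasurableSpace Ω} (hPL : mP ≤ mL) (hL0 : mL ≤ m0)
    (ν : Measure Ω) [IsFiniteMeasure ν] (ρ : Ω → NNReal) (hρ0 : Measurable ρ)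
    [IsFiniteMeasure (ν.withDensity fun x => (ρ x : ℝ≥0∞))]
    (θ η C : ℝ) (hθ : 0 ≤ θ) (hη : 0 ≤ η) (hC : 0 ≤ C)
    (hρL : ∃ ρL : Ω → NNReal, Measurable[mL] ρL ∧ ∀ x, ρL x ≤ ρ x ∧ (ρ x : ℝ) ≤ (1 + θ) * ρL x)
    (g : Ω → ℝ) (hgm : Measurable g) (hgb : ∀ x, |g x| ≤ C)
    (hleaf : ∀ᵐ x ∂ν, |MeasureTheory.condExp mL ν g x - MeasureTheory.condExp mP ν g x| ≤ η) :
    ∫ x, |MeasureTheory.condExp mP (ν.withDensity fun x => (ρ x : ℝ≥0∞)) g x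
        - MeasureTheory.condExp mP ν g x| ∂(ν.withDensity fun x => (ρ x : ℝ≥0∞))
      ≤ (η + 2 * C * θ) * ((ν.withDensity fun x => (ρ x : ℝ≥0∞)) Set.univ).toReal := by
  sorry

/-- Velocity / position space `ℝ³` (the tree's `Literature.MathematicalPhysics.KineticTheory.V3` is this
type; spelled out to keep the sketch's imports minimal). -/
abbrev V3 : Type := EuclideanSpace ℝ (Fin 3)

/-- **No lever arm inside an exact-velocity atom.** Along a free flight with the velocity held
EXACTLY fixed, a position perturbation `δ` of a sphere lands displaced by exactly `‖δ‖` (isometry):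
to move the next impact parameter across the `ε`-disc one must shift an earlier contact
configuration by `ε` itself (factor-1 inheritance) or rotate the previous collision shell.
[folklore] -/
theorem leverArm_exactVelocity (x δ v : V3) (t : ℝ) :
    ‖(x + δ + t • v) - (x + t • v)‖ = ‖δ‖ := by
  have h : (x + δ + t • v) - (x + t • v) = δ := by abel
  rw [h]

/-- **Lever arm along an unstable leaf.** Along a post-collision unstable direction the velocity
perturbation is `c • δ` with `c ≍ 2|u·ω|/ε` (diverging beam off a sphere of radius `ε`), so after a
flight of duration `t` the landing displacement is `(1 + t c)‖δ‖ ≍ (ℓ_f/ε)‖δ‖`: a leaf segment of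
transverse extent `ε²/ℓ_f` (velocity extent `≍ σ³|u|`) sweeps the whole `ε`-disc. [folklore] -/
theorem leverArm_leaf (δ : V3) (t c : ℝ) (ht : 0 ≤ t) (hc : 0 ≤ c) :
    ‖δ + t • (c • δ)‖ = (1 + t * c) * ‖δ‖ := by
  have h : δ + t • (c • δ) = (1 + t * c) • δ := by
    rw [smul_smul, add_smul, one_smul]
  rw [h, norm_smul, Real.norm_eq_abs, abs_of_nonneg (by positivity)]

end Summit.AtomisticToContinuum.HydrodynamicLimit.Cruxes.KickFairRelEquilibriumMeso.LeafReweighting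

end
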